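import Summits.QuantumFields.BalabanUV.Beta.D1BFx.SortedPack
import Summits.QuantumFields.BalabanUV.Beta.D1BFx.PeriodicArrays
import Summits.QuantumFields.BalabanUV.Beta.D1BFx.MixedVarPackedHess

/-!
# `BalabanUV.Beta.D1BFx.SortedEmbedding` — road «BF-x», binder row D1, slot (K), debt X₃(ii) ROUTE T, brick **«K-GLUE»: THE SORTED CURRENCY
# (TB1∕TB2: block matrices over the COARSE torus `Site D p`, fine bonds re-blocked, where `M_T`, `N_T` are invertible) AND THE FINE-TORUS
# EMBEDDED CURRENCY (TA2∕TA3: `periodiseF (n·p) (toF ·)` over `Site D (n·p) × (F ⊕ F)`, where the limits `hessT → hessKer` live) CARRY THE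
# SAME TRACES** — the index embedding `emb`, `(sortK n K)^ = ((toF K)^).submatrix emb emb`, the dead complement (off-lattice multiplier indices),
# and the transfer of `trace`, products and `hessT` for lattice-supported packs

WHY (K-ASSEMBLY-SPEC v1 §1, between TB1∕TB2 and TA3b∕TA4, for TB5).  TA4 (`MixedVarPackedHess.mixedVar_kkt_fromRows_zero_of_mul_eq_one`) turns
the model's `mixedVar M_T …` into `2·hessT (X.submatrix e e) Jₛ Jₜ Jₛₜ` and TB1 (`TorusCombKKT.inv_MT_packed_eq`) identifies that corner with
`diag(1,−1)·(sortK n G)^` — a matrix over `(Site p × ((ℤ∕n)^D × F)) ⊕ (Site p × F)`.  TA3b (`TorusTraceTadpole.tendsto_hessT_hessKer`) sends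
`hessT` of FINE-torus periodisations `(toF A)^`, `(toF (arr V))^` over `Site (n·p) × (F ⊕ F)` to `hessKer`.  THIS FILE shows the two currencies
give the same `hessT` as soon as the LEG's multiplier rows AND columns vanish off the coarse sublattice (`KInv`, `coDressKBmAt ρ n (KInvStep n j)`:
`KInv_inr_off`, `coDressKBmAt_KInvStep_inr_row∕col_off`) — the jets are arbitrary: the sorted matrix IS the sub-matrix of the embedded one along
`emb`, and the complement of `range emb` is DEAD for the leg (zero rows and columns), and every dead index of a trace word meets a leg entry.
CONTENT (all [folklore] ∕ [our object]; generic `D`, finite fibre `F`, block side `n ≥ 1`, coarse period `p ≥ 1`, `s = n·p`):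
* §1 [folklore] FINITE BOOKKEEPING ALONG AN INJECTION WITH A DEAD COMPLEMENT: `trace_submatrix_of_dead`, `submatrix_mul_submatrix_of_dead_cols`,
  `trace_mul_submatrix_of_dead_rows∕_left`, `trace_submatrix_equiv'`, `hessT_submatrix_equiv`∕`hessT_reindex`, **`hessT_submatrix_of_dead_leg`**
  (ONLY THE LEG needs dead rows and columns; the three jets are arbitrary — every dead index meets a leg entry).
* §2 [our object] `emb n p : Site D p × (((ℤ∕n)^D × F) ⊕ F) → Site D (n·p) × (F ⊕ F)` (`torusBlockEquiv`, coarse legs at in-block position `0`);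
  [folklore] `emb_injective`, **`not_mem_range_emb_iff`** (the complement = multiplier indices at fine torus points OFF the coarse sublattice).
* §3 [folklore] **`periodiseF_sortK_eq_submatrix`**: `of (periodiseF p (sortK n K)) = (of (periodiseF (n·p) (toF K))).submatrix (emb n p) (emb n p)`
  (TA1 `periodiseF_reblock`); **`dead_of_latticeSupported`**: for a pack with off-lattice-zero multiplier rows and columns, `(toF K)^` has zero rows and
  columns off `range emb`.
* §3b [our object] **`e₁ n p : Site D p × ((ℤ∕n)^D × F) ≃ Site D (n·p) × F`** (ONE sort; owner ruling ρ-g6-2b) with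
  **`periodiseF_reblock_eq_submatrix`** (`(reblock n K)^ = ((toF K)^).submatrix e₁ e₁`), `periodiseF_toF_eq_submatrix_reblock`, `reblock_hat_mul`,
  `reblock_hat_mul_eq_one` (inverse pairs on the fine torus `Site D (n·p) × F` — e.g. `VectorPropagatorImages.periodiseF_X1aKer_mul_GaF` — ARE
  inverse pairs on the coarse base, for the N-side Woodbury TB2 3c).
* §4 [folklore] **`hessT_sorted_eq_embedded`**: `hessT (sortK n L)^ (sortK n V)^ (sortK n V′)^ (sortK n W)^ = hessT (toF L)^ (toF V)^ (toF V′)^ (toF W)^`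
  for a lattice-supported LEG `L` (multiplier rows and columns `0` off `n•ℤ^D`) and ANY jointly periodic jets, and the `blocksHat` (re-indexed)
  form `hessT_blocksHat_eq_embedded`.  (The `flipRows` device and the wall's leg: PART 2 `SortedEmbeddingWall`.)
NOT HERE: the limit itself (TA3b), any road letter, the jets = tables dictionary (TB4), estimates.
HONEST FRAMING (cell contract, verbatim): «discharging `BetaPertH` makes Bałaban's UV stability UNCONDITIONAL — a real constructive-QFT
result; it is NOT the continuum limit and NOT the Clay problem.»  HONEST DEPENDENCY (verbatim): «continuum YM on T⁴ ⇐ BetaPertH ∧ nine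
spine estimates (0/9 proved); BetaPertH ⇐ (D1) ∧ (D4) ∧ CAP+tail; G-an2-4 gates asym, D1 and NE2/3/4.»  [folklore] bookkeeping over TA1
(`SortedReblocking`∕`SortedPack`), TA2 (`PeriodicArrays.toF`), TA4 (`MixedVarPackedHess.hessT`) BY NAME; no `Prop` is minted, nothing is cited, no
wall binder is instantiated; 0 sorry.  NOT D1, NOT BetaPertH, NOT summit progress.  ABSOLUTE RULE (cell, verbatim): «No internally-minted statement
may enter as a cited fact. Every hypothesis is either kernel-proved in this package or a verbatim quotation of a PUBLISHED theorem with page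
reference. The manuscript(s) under audit are NOT citable for their own disputed steps — they are the thing under adjudication; programme-internal
(2001/route/tribunal) claims are never citable.»  Provenance: D1 formalisation swarm, unit `b2b-balaban-beta-d1-formalise-leaf-03` (gen 8), brick «K-GLUE», 2026-08-20.
-/

noncomputable section

namespace Summit.QuantumFields.BalabanUV.Beta.D1BFx.SortedEmbedding

open Matrix
open Literature.Probability.LatticeModels (TorusSite Torus.proj Torus.proj_apply)
open Literature.MathematicalPhysics.QuantumFieldTheory.LatticeForm (repZ quo proj_add_zsmul)
open Literature.MathematicalPhysics.QuantumFieldTheory.Balaban1983to89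
open Literature.MathematicalPhysics.QuantumFieldTheory.Balaban1983to89.Beta
open ExpKernelCalculus (MKer)
open Summit.QuantumFields.BalabanUV.Beta.D1BFx.FibredPeriodisation
open Summit.QuantumFields.BalabanUV.Beta.D1BFx.SortedKernels
open Summit.QuantumFields.BalabanUV.Beta.D1BFx.SortedReblocking
open Summit.QuantumFields.BalabanUV.Beta.D1BFx.SortedPack
open Summit.QuantumFields.BalabanUV.Beta.D1BFx.PeriodicArrays (toF Kfib_toF)
open Summit.QuantumFields.BalabanUV.Beta.D1BFx.MixedVarPackedHess (hessT)
open scoped BigOperators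

/-! ## §1 Finite bookkeeping along an injection with a dead complement -/

section Dead
variable {α β : Type*} [Fintype α] [Fintype β]

/-- [folklore] A sum over `β` of a function vanishing off the range of an injection `e : α → β` is the sum over `α` of its pull-back. -/
theorem sum_eq_sum_comp_of_dead {e : α → β} (he : Function.Injective e) {f : β → ℝ} (hf : ∀ k, k ∉ Set.range e → f k = 0) :
    ∑ k, f k = ∑ q, f (e q) :=
  (Fintype.sum_of_injective e he (fun q => f (e q)) f hf (fun _ => rfl)).symm

/-- [folklore] **TRACE ALONG AN INJECTION**: if the diagonal of `M` vanishes off `range e`, `trace (M.submatrix e e) = trace M`. -/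
theorem trace_submatrix_of_dead {e : α → β} (he : Function.Injective e) {M : Matrix β β ℝ}
    (hM : ∀ k, k ∉ Set.range e → M k k = 0) : Matrix.trace (M.submatrix e e) = Matrix.trace M := by
  simp only [Matrix.trace, Matrix.diag_apply, Matrix.submatrix_apply]
  exact (sum_eq_sum_comp_of_dead he hM).symm

/-- [folklore] **PRODUCTS ALONG AN INJECTION (dead columns of the left factor)**: `(L.sub)·(V.sub) = (L·V).sub`. -/
theorem submatrix_mul_submatrix_of_dead_cols {e : α → β} (he : Function.Injective e) {L : Matrix β β ℝ}
    (hLc : ∀ k', k' ∉ Set.range e → ∀ k, L k k' = 0) (V : Matrix β β ℝ) :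
    L.submatrix e e * V.submatrix e e = (L * V).submatrix e e := by
  ext i j
  simp only [Matrix.mul_apply, Matrix.submatrix_apply]
  symm
  exact sum_eq_sum_comp_of_dead he (f := fun k => L (e i) k * V k (e j)) (fun k hk => by rw [hLc k hk, zero_mul])

omit [Fintype α] in
/-- [folklore] Rows of a product vanish where the rows of the left factor vanish. -/
theorem mul_row_dead {e : α → β} {M : Matrix β β ℝ} (hM : ∀ k, k ∉ Set.range e → ∀ k', M k k' = 0) (N : Matrix β β ℝ) :
    ∀ k, k ∉ Set.range e → ∀ k', (M * N) k k' = 0 := by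
  intro k hk k'
  rw [Matrix.mul_apply]
  exact Finset.sum_eq_zero fun j _ => by rw [hM k hk, zero_mul]

/-- [folklore] **TRACE OF A PRODUCT ALONG AN INJECTION**: if `A` has dead rows and `B` has dead rows off `range e` — or `A` has dead rows AND
dead columns — then `trace (A.sub · B.sub) = trace (A · B)`.  (Rows-rows form.) -/
theorem trace_mul_submatrix_of_dead_rows {e : α → β} (he : Function.Injective e) {A B : Matrix β β ℝ}
    (hA : ∀ k, k ∉ Set.range e → ∀ k', A k k' = 0) (hB : ∀ k, k ∉ Set.range e → ∀ k', B k k' = 0) :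
    Matrix.trace (A.submatrix e e * B.submatrix e e) = Matrix.trace (A * B) := by
  simp only [Matrix.trace, Matrix.diag_apply, Matrix.mul_apply, Matrix.submatrix_apply]
  rw [sum_eq_sum_comp_of_dead he (f := fun k => ∑ k', A k k' * B k' k)
    (fun k hk => Finset.sum_eq_zero fun k' _ => by rw [hA k hk, zero_mul])]
  refine Finset.sum_congr rfl fun i _ => ?_
  symm
  exact sum_eq_sum_comp_of_dead he (f := fun k' => A (e i) k' * B k' (e i)) (fun k' hk' => by rw [hB k' hk', mul_zero])

/-- [folklore] (Rows-and-columns-of-the-left-factor form.) `trace (L.sub · W.sub) = trace (L · W)` for `L` with dead rows and columns, ANY `W`. -/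
theorem trace_mul_submatrix_of_dead_left {e : α → β} (he : Function.Injective e) {L : Matrix β β ℝ}
    (hLr : ∀ k, k ∉ Set.range e → ∀ k', L k k' = 0) (hLc : ∀ k', k' ∉ Set.range e → ∀ k, L k k' = 0) (W : Matrix β β ℝ) :
    Matrix.trace (L.submatrix e e * W.submatrix e e) = Matrix.trace (L * W) := by
  simp only [Matrix.trace, Matrix.diag_apply, Matrix.mul_apply, Matrix.submatrix_apply]
  rw [sum_eq_sum_comp_of_dead he (f := fun k => ∑ k', L k k' * W k' k)
    (fun k hk => Finset.sum_eq_zero fun k' _ => by rw [hLr k hk, zero_mul])]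
  refine Finset.sum_congr rfl fun i _ => ?_
  symm
  exact sum_eq_sum_comp_of_dead he (f := fun k' => L (e i) k' * W k' (e i)) (fun k' hk' => by rw [hLc k' hk', zero_mul])

/-- [folklore] **`hessT` ALONG AN INJECTION, LEG-ONLY HYPOTHESES**: if the LEG `L` has zero rows AND zero columns off `range e`, then for ANY jets
`V`, `V′`, `W`: `hessT (L.sub) (V.sub) (V′.sub) (W.sub) = hessT L V V′ W` (`sub := submatrix e e`) — every dead index meets a leg entry. -/
theorem hessT_submatrix_of_dead_leg {e : α → β} (he : Function.Injective e) {L : Matrix β β ℝ}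
    (hLr : ∀ k, k ∉ Set.range e → ∀ k', L k k' = 0) (hLc : ∀ k', k' ∉ Set.range e → ∀ k, L k k' = 0) (V V' W : Matrix β β ℝ) :
    hessT (L.submatrix e e) (V.submatrix e e) (V'.submatrix e e) (W.submatrix e e) = hessT L V V' W := by
  unfold hessT
  rw [trace_mul_submatrix_of_dead_left he hLr hLc W, submatrix_mul_submatrix_of_dead_cols he hLc V,
    submatrix_mul_submatrix_of_dead_cols he hLc V',
    trace_mul_submatrix_of_dead_rows he (mul_row_dead hLr V) (mul_row_dead hLr V')]

/-- [folklore] Trace is invariant under re-indexing by an equivalence. -/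
theorem trace_submatrix_equiv' (e : α ≃ β) (M : Matrix β β ℝ) : Matrix.trace (M.submatrix e e) = Matrix.trace M := by
  simp only [Matrix.trace, Matrix.diag_apply, Matrix.submatrix_apply]
  exact e.sum_comp (fun j => M j j)

/-- [folklore] `hessT` is invariant under simultaneous re-indexing of the four arguments by an equivalence. -/
theorem hessT_submatrix_equiv (e : α ≃ β) (L V V' W : Matrix β β ℝ) :
    hessT (L.submatrix e e) (V.submatrix e e) (V'.submatrix e e) (W.submatrix e e) = hessT L V V' W := by
  unfold hessT
  rw [Matrix.submatrix_mul_equiv, Matrix.submatrix_mul_equiv, Matrix.submatrix_mul_equiv, Matrix.submatrix_mul_equiv,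
    trace_submatrix_equiv', trace_submatrix_equiv']

/-- [folklore] The `reindex` form of the invariance. -/
theorem hessT_reindex (e : β ≃ α) (L V V' W : Matrix β β ℝ) :
    hessT (Matrix.reindex e e L) (Matrix.reindex e e V) (Matrix.reindex e e V') (Matrix.reindex e e W) = hessT L V V' W := by
  simp only [Matrix.reindex_apply]
  exact hessT_submatrix_equiv e.symm L V V' W

end Dead

/-! ## §2 The index embedding of the sorted currency into the fine-torus currency -/

section Emb
variable {D : ℕ} {F : Type*} (n p : ℕ) [NeZero n] [NeZero p]

/-- [our object] **THE INDEX EMBEDDING**: a sorted index (coarse torus point, fine-bond fibre `(z, a)` ∕ coarse-bond fibre `a`) ↦ the fine torus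
point of the block at in-block position `z` (resp. `0`) with packed fibre `inl a` (resp. `inr a`). -/
def emb (q : Beta.Site D p × ((TorusSite D n × F) ⊕ F)) : Beta.Site D (n * p) × (F ⊕ F) :=
  (torusBlockEquiv n p (q.1, (ι q.2).1), (ι q.2).2)

/-- [our object] `emb` on a fine-bond index. -/
theorem emb_inl (ybar : Beta.Site D p) (z : TorusSite D n) (a : F) :
    emb n p (ybar, Sum.inl (z, a)) = (torusBlockEquiv n p (ybar, z), Sum.inl a) := rfl

/-- [our object] `emb` on a coarse-bond index. -/
theorem emb_inr (ybar : Beta.Site D p) (a : F) :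
    emb n p (ybar, Sum.inr a) = (torusBlockEquiv n p (ybar, 0), Sum.inr a) := rfl

omit [NeZero n] [NeZero p] in
/-- [folklore] The sort injection `ι` is injective. -/
theorem ι_injective : Function.Injective (ι : (TorusSite D n × F) ⊕ F → TorusSite D n × (F ⊕ F)) := by
  rintro (⟨z, a⟩ | a) (⟨z', a'⟩ | a') h
  · simp only [ι_inl, Prod.mk.injEq, Sum.inl.injEq] at h
    rw [h.1, h.2]
  · simp only [ι_inl, ι_inr, Prod.mk.injEq] at h
    exact absurd h.2 (by simp)
  · simp only [ι_inl, ι_inr, Prod.mk.injEq] at h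
    exact absurd h.2 (by simp)
  · simp only [ι_inr, Prod.mk.injEq, Sum.inr.injEq, true_and] at h
    rw [h]

/-- [folklore] **`emb` IS INJECTIVE.** -/
theorem emb_injective : Function.Injective (emb (D := D) (F := F) n p) := by
  intro q q' h
  obtain ⟨y, i⟩ := q
  obtain ⟨y', i'⟩ := q'
  simp only [emb, Prod.mk.injEq] at h
  obtain ⟨h1, h2⟩ := h
  have h1' := (torusBlockEquiv n p).injective h1
  simp only [Prod.mk.injEq] at h1'
  have hi : ι i = ι i' := Prod.ext h1'.2 h2
  rw [h1'.1, ι_injective n hi]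

/-- [folklore] Every fine-bond index of the fine torus is in the range of `emb`. -/
theorem mem_range_emb_inl (x : Beta.Site D (n * p)) (a : F) : (x, Sum.inl a) ∈ Set.range (emb (D := D) (F := F) n p) := by
  refine ⟨(((torusBlockEquiv n p).symm x).1, Sum.inl (((torusBlockEquiv n p).symm x).2, a)), ?_⟩
  rw [emb_inl, Prod.mk.eta, Equiv.apply_symm_apply]

/-- [folklore] A multiplier index `(x, inr a)` is in the range of `emb` iff the fine torus point `x` lies on the coarse sublattice
(its representative has residue `0` mod `n`). -/
theorem mem_range_emb_inr_iff (x : Beta.Site D (n * p)) (a : F) :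
    (x, Sum.inr a) ∈ Set.range (emb (D := D) (F := F) n p) ↔ Torus.proj n (windowMap D (n * p) x) = 0 := by
  constructor
  · rintro ⟨⟨y, i⟩, h⟩
    rcases i with ⟨z, b⟩ | b
    · simp only [emb_inl, Prod.mk.injEq] at h
      exact absurd h.2 (by simp)
    · simp only [emb_inr, Prod.mk.injEq] at h
      have hx : (torusBlockEquiv n p).symm x = (y, 0) := by rw [← h.1, Equiv.symm_apply_apply]
      have := congrArg Prod.snd hx
      exact this
  · intro hx
    refine ⟨(((torusBlockEquiv n p).symm x).1, Sum.inr a), ?_⟩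
    rw [emb_inr]
    have h2 : ((torusBlockEquiv n p).symm x).2 = 0 := hx
    have : ((((torusBlockEquiv n p).symm x).1, (0 : TorusSite D n)) : Beta.Site D p × TorusSite D n) = (torusBlockEquiv n p).symm x := by
      rw [← h2]
    rw [this, Equiv.apply_symm_apply]

/-- [folklore] **THE COMPLEMENT OF `range emb`** = the multiplier indices at fine torus points OFF the coarse sublattice. -/
theorem not_mem_range_emb_iff (k : Beta.Site D (n * p) × (F ⊕ F)) :
    k ∉ Set.range (emb (D := D) (F := F) n p) ↔ ∃ x a, k = (x, Sum.inr a) ∧ Torus.proj n (windowMap D (n * p) x) ≠ 0 := by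
  obtain ⟨x, c⟩ := k
  rcases c with a | a
  · simp only [mem_range_emb_inl, not_true_eq_false, Prod.mk.injEq, false_iff, not_exists, not_and]
    intro x' a' h; exact absurd h.2 (by simp)
  · rw [mem_range_emb_inr_iff]
    constructor
    · intro h; exact ⟨x, a, rfl, h⟩
    · rintro ⟨x', a', h, hx'⟩
      simp only [Prod.mk.injEq, Sum.inr.injEq] at h
      rw [h.1]; exact hx'

end Emb

/-! ## §3 The sorted matrix is the sub-matrix of the embedded one; the complement is dead for lattice-supported packs -/

section Sub
variable {D : ℕ} {F : Type*} {n p : ℕ} [NeZero n] [NeZero p]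

/-- [folklore] `periodiseF_reblock` with the fibre as a pair variable. -/
theorem periodiseF_reblock' {G : Type*} {K : MKer D G} (w w' : TorusSite D n × G)
    (hper : IsPeriodic₂ (n * p) (fun x x' => K x x' w.2 w'.2)) (hrow : ∀ x, Summable fun x' => K x x' w.2 w'.2)
    (ybar ybar' : Beta.Site D p) :
    periodiseF p (reblock n K) (ybar, w) (ybar', w')
      = periodise₂ (n * p) (fun x x' => K x x' w.2 w'.2) (torusBlockEquiv n p (ybar, w.1)) (torusBlockEquiv n p (ybar', w'.1)) := by
  obtain ⟨z, a⟩ := w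
  obtain ⟨z', b⟩ := w'
  exact periodiseF_reblock hper hrow ybar ybar' z z'

/-- [folklore] **`(sortK n K)^ = ((toF K)^).submatrix emb emb`** — the coarse-base periodisation of the sorted pack IS the fine-torus periodisation of
the pack read along the embedding (TA1's `periodiseF_reblock`), for jointly `(n·p)`-periodic fibres with summable rows. -/
theorem periodiseF_sortK_eq_submatrix {K : MKer D (F ⊕ F)} (hper : ∀ c c', IsPeriodic₂ (n * p) (fun x x' => K x x' c c'))
    (hrow : ∀ c c' x, Summable fun x' => K x x' c c') :
    Matrix.of (periodiseF p (sortK n K)) = (Matrix.of (periodiseF (n * p) (toF K))).submatrix (emb n p) (emb n p) := by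
  ext ⟨y, i⟩ ⟨y', j⟩
  rw [Matrix.submatrix_apply, Matrix.of_apply, Matrix.of_apply]
  show periodiseF p (reblock n K) (y, ι i) (y', ι j)
    = periodiseF (n * p) (toF K) (torusBlockEquiv n p (y, (ι i).1), (ι i).2) (torusBlockEquiv n p (y', (ι j).1), (ι j).2)
  rw [periodiseF_reblock' (ι i) (ι j) (hper _ _) (hrow _ _), periodiseF_apply, Kfib_toF]

omit [NeZero n] [NeZero p] in
/-- [folklore] A fine image shift of period `n·p` does not change the residue mod `n`. -/
theorem proj_imageShift_mul (x t : Fin D → ℤ) : Torus.proj n (imageShift (n * p) x t) = Torus.proj n x := by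
  rw [imageShift_mul_eq_add, proj_add_zsmul]

/-- [folklore] **THE COMPLEMENT IS DEAD (rows)**: if the multiplier rows of `K` vanish off the coarse sublattice, the rows of `(toF K)^` vanish off
`range emb`. -/
theorem row_dead_of_latticeSupported {K : MKer D (F ⊕ F)} (hK : ∀ y z f b, Torus.proj n y ≠ 0 → K y z (Sum.inr f) b = 0) :
    ∀ k, k ∉ Set.range (emb (D := D) (F := F) n p) → ∀ k', Matrix.of (periodiseF (n * p) (toF K)) k k' = 0 := by
  intro k hk k'
  obtain ⟨x, a, rfl, hx⟩ := (not_mem_range_emb_iff n p k).1 hk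
  obtain ⟨x', c'⟩ := k'
  rw [Matrix.of_apply, periodiseF_apply, Kfib_toF]
  unfold periodise₂
  rw [show (fun t : Fin D → ℤ => K (windowMap D (n * p) x) (imageShift (n * p) (windowMap D (n * p) x') t) (Sum.inr a) c')
      = fun _ => 0 from funext fun t => hK _ _ _ _ hx]
  exact tsum_zero

/-- [folklore] **THE COMPLEMENT IS DEAD (columns)**: if the multiplier columns of `K` vanish off the coarse sublattice, the columns of `(toF K)^`
vanish off `range emb`. -/
theorem col_dead_of_latticeSupported {K : MKer D (F ⊕ F)} (hK : ∀ x y a f, Torus.proj n y ≠ 0 → K x y a (Sum.inr f) = 0) :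
    ∀ k', k' ∉ Set.range (emb (D := D) (F := F) n p) → ∀ k, Matrix.of (periodiseF (n * p) (toF K)) k k' = 0 := by
  intro k' hk' k
  obtain ⟨x', a, rfl, hx'⟩ := (not_mem_range_emb_iff n p k').1 hk'
  obtain ⟨x, c⟩ := k
  rw [Matrix.of_apply, periodiseF_apply, Kfib_toF]
  unfold periodise₂
  rw [show (fun t : Fin D → ℤ => K (windowMap D (n * p) x) (imageShift (n * p) (windowMap D (n * p) x') t) c (Sum.inr a))
      = fun _ => 0 from funext fun t => hK _ _ _ _ (by rw [proj_imageShift_mul]; exact hx')]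
  exact tsum_zero

end Sub

/-! ## §3b One sort: the re-blocked fine kernel is the fine-torus periodisation re-indexed by an EQUIVALENCE -/

section OneSort
variable {D : ℕ} {F : Type*} (n p : ℕ) [NeZero n] [NeZero p]

/-- [our object] **THE ONE-SORTED INDEX EQUIVALENCE** `e₁ : Site D p × ((ℤ∕n)^D × F) ≃ Site D (n·p) × F`, `(ȳ,(z,a)) ↦ (torusBlockEquiv n p (ȳ,z), a)`
(owner ruling ρ-g6-2b: an `Equiv`, so products AND inverses transport — `Matrix.submatrix_mul_equiv`, `Matrix.inv_submatrix_equiv`). -/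
def e₁ : Beta.Site D p × (TorusSite D n × F) ≃ Beta.Site D (n * p) × F :=
  (Equiv.prodAssoc (Beta.Site D p) (TorusSite D n) F).symm.trans ((torusBlockEquiv n p).prodCongr (Equiv.refl F))

/-- [our object] Unfolding of `e₁`. -/
@[simp] theorem e₁_apply (ybar : Beta.Site D p) (z : TorusSite D n) (a : F) :
    e₁ (D := D) (F := F) n p (ybar, (z, a)) = (torusBlockEquiv n p (ybar, z), a) := rfl

variable {n p}

/-- [folklore] **`(reblock n K)^ = ((toF K)^).submatrix e₁ e₁`** for an UNPACKED fine kernel `K : MKer D F` with jointly `(n·p)`-periodic fibres and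
summable rows — the fine-torus periodisation (an5's ∕ `VectorPropagatorImages`' currency `Site D (n·p) × F`) re-indexed to the coarse base. -/
theorem periodiseF_reblock_eq_submatrix {K : MKer D F} (hper : ∀ a b, IsPeriodic₂ (n * p) (fun x x' => K x x' a b))
    (hrow : ∀ a b x, Summable fun x' => K x x' a b) :
    Matrix.of (periodiseF p (reblock n K)) = (Matrix.of (periodiseF (n * p) (toF K))).submatrix (e₁ n p) (e₁ n p) := by
  ext ⟨y, z, a⟩ ⟨y', z', b⟩
  rw [Matrix.submatrix_apply, Matrix.of_apply, Matrix.of_apply, e₁_apply, e₁_apply, periodiseF_reblock (hper a b) (hrow a b),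
    periodiseF_apply, Kfib_toF]

/-- [folklore] The `reindex` form: `(toF K)^ = reindex e₁⁻¹ e₁⁻¹ … ` equivalently `((toF K)^) = (reblock n K)^.submatrix e₁.symm e₁.symm`. -/
theorem periodiseF_toF_eq_submatrix_reblock {K : MKer D F} (hper : ∀ a b, IsPeriodic₂ (n * p) (fun x x' => K x x' a b))
    (hrow : ∀ a b x, Summable fun x' => K x x' a b) :
    Matrix.of (periodiseF (n * p) (toF K)) = (Matrix.of (periodiseF p (reblock n K))).submatrix (e₁ n p).symm (e₁ n p).symm := by
  rw [periodiseF_reblock_eq_submatrix hper hrow, Matrix.submatrix_submatrix]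
  simp only [Equiv.self_comp_symm, Matrix.submatrix_id_id]

/-- [folklore] Products transport: `(reblock n A)^ · (reblock n B)^ = ((toF A)^ · (toF B)^).submatrix e₁ e₁`. -/
theorem reblock_hat_mul {A B : MKer D F} (hA : ∀ a b, IsPeriodic₂ (n * p) (fun x x' => A x x' a b))
    (hAr : ∀ a b x, Summable fun x' => A x x' a b) (hB : ∀ a b, IsPeriodic₂ (n * p) (fun x x' => B x x' a b))
    (hBr : ∀ a b x, Summable fun x' => B x x' a b) [Fintype F] :
    Matrix.of (periodiseF p (reblock n A)) * Matrix.of (periodiseF p (reblock n B))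
      = (Matrix.of (periodiseF (n * p) (toF A)) * Matrix.of (periodiseF (n * p) (toF B))).submatrix (e₁ n p) (e₁ n p) := by
  rw [periodiseF_reblock_eq_submatrix hA hAr, periodiseF_reblock_eq_submatrix hB hBr, Matrix.submatrix_mul_equiv]

/-- [folklore] Inverse pairs transport: if `(toF A)^ · (toF B)^ = 1` on the fine torus then `(reblock n A)^ · (reblock n B)^ = 1` on the coarse base. -/
theorem reblock_hat_mul_eq_one {A B : MKer D F} (hA : ∀ a b, IsPeriodic₂ (n * p) (fun x x' => A x x' a b))
    (hAr : ∀ a b x, Summable fun x' => A x x' a b) (hB : ∀ a b, IsPeriodic₂ (n * p) (fun x x' => B x x' a b))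
    (hBr : ∀ a b x, Summable fun x' => B x x' a b) [Fintype F] [DecidableEq F]
    (h : Matrix.of (periodiseF (n * p) (toF A)) * Matrix.of (periodiseF (n * p) (toF B)) = 1) :
    Matrix.of (periodiseF p (reblock n A)) * Matrix.of (periodiseF p (reblock n B)) = 1 := by
  rw [reblock_hat_mul hA hAr hB hBr, h, Matrix.submatrix_one_equiv]

end OneSort

/-! ## §4 `hessT` agrees in the two currencies -/

section Transfer
variable {D : ℕ} {F : Type*} [Fintype F] {n p : ℕ} [NeZero n] [NeZero p]

/-- [folklore] **`hessT` IN THE SORTED CURRENCY = `hessT` IN THE FINE-TORUS CURRENCY**: for a LEG pack `L` with jointly `(n·p)`-periodic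
fibres, summable rows, and multiplier rows AND columns vanishing off the coarse sublattice, and ANY jet packs `V V′ W` with jointly periodic
fibres and summable rows (e.g. TA2's arrays):
`hessT (sortK n L)^ (sortK n V)^ (sortK n V′)^ (sortK n W)^ = hessT (toF L)^ (toF V)^ (toF V′)^ (toF W)^`
(left: matrices over `Site D p × (((ℤ∕n)^D × F) ⊕ F)`; right: over `Site D (n·p) × (F ⊕ F)`). -/
theorem hessT_sorted_eq_embedded {L V V' W : MKer D (F ⊕ F)}
    (hLp : ∀ c c', IsPeriodic₂ (n * p) (fun x x' => L x x' c c')) (hLr : ∀ c c' x, Summable fun x' => L x x' c c')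
    (hVp : ∀ c c', IsPeriodic₂ (n * p) (fun x x' => V x x' c c')) (hVr : ∀ c c' x, Summable fun x' => V x x' c c')
    (hV'p : ∀ c c', IsPeriodic₂ (n * p) (fun x x' => V' x x' c c')) (hV'r : ∀ c c' x, Summable fun x' => V' x x' c c')
    (hWp : ∀ c c', IsPeriodic₂ (n * p) (fun x x' => W x x' c c')) (hWr : ∀ c c' x, Summable fun x' => W x x' c c')
    (hLo : ∀ y z f b, Torus.proj n y ≠ 0 → L y z (Sum.inr f) b = 0) (hLo' : ∀ x y a f, Torus.proj n y ≠ 0 → L x y a (Sum.inr f) = 0) :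
    hessT (Matrix.of (periodiseF p (sortK n L))) (Matrix.of (periodiseF p (sortK n V))) (Matrix.of (periodiseF p (sortK n V')))
        (Matrix.of (periodiseF p (sortK n W)))
      = hessT (Matrix.of (periodiseF (n * p) (toF L))) (Matrix.of (periodiseF (n * p) (toF V))) (Matrix.of (periodiseF (n * p) (toF V')))
        (Matrix.of (periodiseF (n * p) (toF W))) := by
  rw [periodiseF_sortK_eq_submatrix hLp hLr, periodiseF_sortK_eq_submatrix hVp hVr, periodiseF_sortK_eq_submatrix hV'p hV'r,
    periodiseF_sortK_eq_submatrix hWp hWr]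
  exact hessT_submatrix_of_dead_leg (emb_injective n p) (row_dead_of_latticeSupported hLo) (col_dead_of_latticeSupported hLo') _ _ _

/-- [folklore] The same with the BLOCK matrices `blocksHat p (sortK n ·)` (TB1's currency; `blocksHat = reindex ∘ of ∘ periodiseF`). -/
theorem hessT_blocksHat_eq_embedded {L V V' W : MKer D (F ⊕ F)}
    (hLp : ∀ c c', IsPeriodic₂ (n * p) (fun x x' => L x x' c c')) (hLr : ∀ c c' x, Summable fun x' => L x x' c c')
    (hVp : ∀ c c', IsPeriodic₂ (n * p) (fun x x' => V x x' c c')) (hVr : ∀ c c' x, Summable fun x' => V x x' c c')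
    (hV'p : ∀ c c', IsPeriodic₂ (n * p) (fun x x' => V' x x' c c')) (hV'r : ∀ c c' x, Summable fun x' => V' x x' c c')
    (hWp : ∀ c c', IsPeriodic₂ (n * p) (fun x x' => W x x' c c')) (hWr : ∀ c c' x, Summable fun x' => W x x' c c')
    (hLo : ∀ y z f b, Torus.proj n y ≠ 0 → L y z (Sum.inr f) b = 0) (hLo' : ∀ x y a f, Torus.proj n y ≠ 0 → L x y a (Sum.inr f) = 0) :
    hessT (blocksHat p (sortK n L)) (blocksHat p (sortK n V)) (blocksHat p (sortK n V')) (blocksHat p (sortK n W))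
      = hessT (Matrix.of (periodiseF (n * p) (toF L))) (Matrix.of (periodiseF (n * p) (toF V))) (Matrix.of (periodiseF (n * p) (toF V')))
        (Matrix.of (periodiseF (n * p) (toF W))) := by
  rw [blocksHat_eq_reindex, blocksHat_eq_reindex, blocksHat_eq_reindex, blocksHat_eq_reindex, hessT_reindex]
  exact hessT_sorted_eq_embedded hLp hLr hVp hVr hV'p hV'r hWp hWr hLo hLo'

end Transfer

end Summit.QuantumFields.BalabanUV.Beta.D1BFx.SortedEmbedding

end
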